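import Summits.CriticalPhenomena.Ising3DConformalLimit.Theorems.CoerciveSharpnessCoerciveReflectedGradientDefs
import HarnessLib

/-!
# Route `CoerciveSharpness`, crux `CoerciveReflectedGradient` (stmt-CriticalPhenomena-18197), line `base_box_rerun`:
# registered stub `stub_boxPointwise`

`theorem stub_boxPointwise : Sig.stub_boxPointwise` (vocabulary in
`Theorems/CoerciveSharpnessCoerciveReflectedGradientDefs.lean`): the pointwise inequality of
Duminil-Copin–Panis 2025 (CMP 406 = arXiv:2404.05700), §2.2, eqs. (2.20)–(2.24), for ONE current
configuration, abstracted through connection predicates `c_δ` (`δ = (i, ±)`, the `2d` directions; every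
face point `z_i = ±n` of `Λ_n` satisfies `c_{(i,±)}`), with the base POINT `0` of the random set replaced by
a base BOX `Λ_m`, `1 ≤ m < n`:
`1 ≤ Σ_{z ∈ Λ_m} Σ_δ 𝟙[c_δ z] + w Σ_δ Σ_{x,y ∈ Λ_n, y ∼ x} 𝟙[¬c_δ 0, ¬c_δ x, c_δ y] ⟨σ_0̄σ_x̄⟩_{W_δ}`,
`W_δ = {z̄ : z ∈ Λ_n, ¬c_δ z}` read in the torus `(ℤ/Lℤ)^d`, `L > 2n + 1`, given the base-box boundary input
`BoxInput d β w m n` (`1 ≤ w Σ_{x ∈ S} #{y ∉ S : y ∼ x} ⟨σ₀σ_x⟩^free_S` for all `Λ_m ⊆ S ⊆ Λ_{n-1}`).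
This is the base-box twin of the tree's `DCPNearCritical.pointwise_master_weight`
(`Literature/Probability/LatticeModels/SharpLengthDCPTorus.lean`), whose proof is copied with ONE changed
step: the dichotomy is "some `z ∈ Λ_m` is connected in some direction" (then the indicator double sum is
`≥ 1`) versus "no point of `Λ_m` is connected" (then `Λ_m ⊆ S := {z ∈ Λ_n : ¬c_δ z ∀ δ} ⊆ Λ_{n-1}`, the box
input applies to `S`, and each boundary term `⟨σ₀σ_x⟩_S`, `x ∈ S`, `y ∼ x`, `y ∉ S` — so `c_δ y` for some
`δ` — is at most `⟨σ_0̄σ_x̄⟩_{W_δ}` by Griffiths' monotonicity, `S̄ ⊆ W_δ`). Helper file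
(`--supports stmt-CriticalPhenomena-18197`); no definition, no named fact as hypothesis.
-/

noncomputable section

open Finset

namespace Summit.CriticalPhenomena.Ising3DConformalLimit.Cruxes.CoerciveReflectedGradient.BaseBoxRerun

open scoped BigOperators Classical
open Literature.Probability.LatticeModels
open Literature.Probability.LatticeModels.DCPLower

/-- **Stub A of line `base_box_rerun` — the pointwise inequality with a base box** (Duminil-Copin–Panis
2025, §2.2, eqs. (2.20)–(2.24), one current configuration, base box `Λ_m` in place of the base point `0`):
for predicates `c_δ` on `Λ_n ⊂ ℤ^d` containing the faces, `W_δ = {z̄ : z ∈ Λ_n, ¬c_δ z} ⊂ (ℤ/Lℤ)^d`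
(`L > 2n+1`), a weight `w ≥ 0`, `β ≥ 0` and the box input `BoxInput d β w m n` (`1 ≤ m < n`),
`1 ≤ Σ_{z ∈ Λ_m} Σ_δ 𝟙[c_δ z] + w Σ_δ Σ_{x,y ∈ Λ_n, y ∼ x} 𝟙[¬c_δ 0, ¬c_δ x, c_δ y] ⟨σ_0̄σ_x̄⟩^free_{W_δ}`.
Proof: the tree's `DCPNearCritical.pointwise_master_weight` with the dichotomy on `∃ z ∈ Λ_m, ∃ δ, c_δ z`
and the box input applied to `S = {z ∈ Λ_n : ∀ δ, ¬c_δ z} ⊇ Λ_m`. -/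
theorem stub_boxPointwise : Sig.stub_boxPointwise := by
  unfold Sig.stub_boxPointwise BoxInput
  intro d L _ m n hm hmn hnL β w hβ hw hφ c hface
  classical
  have hn : 1 ≤ n := by omega
  set W : Fin d × Bool → Finset (TorusSite d L) :=
    fun δ => ((box d n).filter fun z => ¬ c δ z).image (Torus.proj L) with hW
  have h0box : (0 : Site d) ∈ box d n := zero_mem_box d n
  have hmemW : ∀ {δ : Fin d × Bool} {z : Site d}, z ∈ box d n → ¬ c δ z → Torus.proj L z ∈ W δ :=
    fun hz hc => mem_image.2 ⟨_, mem_filter.2 ⟨hz, hc⟩, rfl⟩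
  -- every summand of the triple sum is nonnegative
  have hterm : ∀ δ, ∀ x ∈ box d n, ∀ y, 0 ≤ (if (zdGraph d).Adj x y ∧ ¬ c δ 0 ∧ ¬ c δ x ∧ c δ y then
      isingTwoPoint (torusGraph d L) (W δ) β 0 .free (Torus.proj L 0) (Torus.proj L x) else 0) := by
    intro δ x hx y
    split_ifs with h
    · exact isingTwoPoint_free_nonneg_of_mem _ hβ (hmemW h0box h.2.1) (hmemW hx h.2.2.1)
    · exact le_rfl
  have htriple : 0 ≤ ∑ δ : Fin d × Bool, ∑ x ∈ box d n, ∑ y ∈ box d n,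
      (if (zdGraph d).Adj x y ∧ ¬ c δ 0 ∧ ¬ c δ x ∧ c δ y then
        isingTwoPoint (torusGraph d L) (W δ) β 0 .free (Torus.proj L 0) (Torus.proj L x) else 0) :=
    sum_nonneg fun δ _ => sum_nonneg fun x hx => sum_nonneg fun y _ => hterm δ x hx y
  have hind : 0 ≤ ∑ z ∈ box d m, ∑ δ : Fin d × Bool, (if c δ z then (1 : ℝ) else 0) :=
    sum_nonneg fun z _ => sum_nonneg fun δ _ => by split_ifs <;> norm_num
  by_cases h0 : ∃ z ∈ box d m, ∃ δ, c δ z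
  · -- some point of the base box is connected in some direction
    obtain ⟨z₀, hz₀, δ₀, hδ₀⟩ := h0
    have hz1 : (1 : ℝ) ≤ ∑ δ : Fin d × Bool, (if c δ z₀ then (1 : ℝ) else 0) := by
      have := Finset.single_le_sum (f := fun δ : Fin d × Bool => if c δ z₀ then (1 : ℝ) else 0)
        (fun δ _ => by split_ifs <;> norm_num) (mem_univ δ₀)
      simp only [if_pos hδ₀] at this
      exact this
    have h1 : (1 : ℝ) ≤ ∑ z ∈ box d m, ∑ δ : Fin d × Bool, (if c δ z then (1 : ℝ) else 0) :=
      hz1.trans (Finset.single_le_sum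
        (f := fun z : Site d => ∑ δ : Fin d × Bool, (if c δ z then (1 : ℝ) else 0))
        (fun z _ => sum_nonneg fun δ _ => by split_ifs <;> norm_num) hz₀)
    nlinarith [mul_nonneg hw htriple]
  · push Not at h0
    -- no point of the base box is connected: in particular the origin is not
    have h00 : ∀ δ, ¬ c δ 0 := h0 0 (zero_mem_box d m)
    -- the random set `S`
    set S : Finset (Site d) := (box d n).filter fun z => ∀ δ, ¬ c δ z with hS
    have h0S : (0 : Site d) ∈ S := mem_filter.2 ⟨h0box, h00⟩
    have hmS : box d m ⊆ S := fun z hz => mem_filter.2 ⟨box_mono d hmn.le hz, h0 z hz⟩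
    have hSbox : S ⊆ box d n := filter_subset _ _
    have hSpred : S ⊆ box d (n - 1) := by
      intro z hz
      obtain ⟨hzbox, hzc⟩ := mem_filter.1 hz
      refine mem_box_pred_of_forall_ne hzbox fun i => ⟨fun h => hzc (i, true) ((hface z hzbox i).1 h),
        fun h => hzc (i, false) ((hface z hzbox i).2 h)⟩
    have hSW : ∀ δ, S.image (Torus.proj L) ⊆ W δ := by
      intro δ v hv
      obtain ⟨z, hz, rfl⟩ := mem_image.1 hv
      obtain ⟨hzbox, hzc⟩ := mem_filter.1 hz
      exact hmemW hzbox (hzc δ)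
    have hφS := hφ S hmS hSpred
    -- termwise bound
    have hA : ∀ x ∈ S, ∀ y ∈ ((zdGraph d).neighborFinset x).filter (fun y => y ∉ S),
        isingTwoPoint (zdGraph d) S β 0 .free 0 x ≤
          ∑ δ : Fin d × Bool,
            (if (zdGraph d).Adj x y ∧ ¬ c δ 0 ∧ ¬ c δ x ∧ c δ y then
              isingTwoPoint (torusGraph d L) (W δ) β 0 .free (Torus.proj L 0) (Torus.proj L x) else 0) := by
      intro x hx y hy
      obtain ⟨hyadj, hyS⟩ := mem_filter.1 hy
      rw [SimpleGraph.mem_neighborFinset] at hyadj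
      have hybox : y ∈ box d n := mem_box_of_adj_of_mem_box_pred hn (hSpred hx) hyadj
      have hyc : ∃ δ, c δ y := by
        by_contra hne
        push Not at hne
        exact hyS (mem_filter.2 ⟨hybox, hne⟩)
      obtain ⟨δ₁, hδ₁⟩ := hyc
      obtain ⟨hxbox, hxc⟩ := mem_filter.1 hx
      have hcond : (zdGraph d).Adj x y ∧ ¬ c δ₁ 0 ∧ ¬ c δ₁ x ∧ c δ₁ y := ⟨hyadj, h00 δ₁, hxc δ₁, hδ₁⟩
      -- `⟨σ₀σ_x⟩_S` (in `ℤ^d`) `= ⟨σ_{0̄}σ_{x̄}⟩_{S̄}` (torus) `≤ ⟨σ_{0̄}σ_{x̄}⟩_{W_{δ₁}}`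
      have htrans : isingTwoPoint (zdGraph d) S β 0 .free 0 x ≤
          isingTwoPoint (torusGraph d L) (W δ₁) β 0 .free (Torus.proj L 0) (Torus.proj L x) := by
        rw [Torus.isingTwoPoint_free_eq_torus hnL hSbox β h0S hx]
        exact isingTwoPoint_free_le_of_subset _ hβ (hSW δ₁) (mem_image_of_mem _ h0S) (mem_image_of_mem _ hx)
      calc isingTwoPoint (zdGraph d) S β 0 .free 0 x
          ≤ (if (zdGraph d).Adj x y ∧ ¬ c δ₁ 0 ∧ ¬ c δ₁ x ∧ c δ₁ y then
              isingTwoPoint (torusGraph d L) (W δ₁) β 0 .free (Torus.proj L 0) (Torus.proj L x) else 0) := by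
            rw [if_pos hcond]
            exact htrans
        _ ≤ ∑ δ : Fin d × Bool,
            (if (zdGraph d).Adj x y ∧ ¬ c δ 0 ∧ ¬ c δ x ∧ c δ y then
              isingTwoPoint (torusGraph d L) (W δ) β 0 .free (Torus.proj L 0) (Torus.proj L x) else 0) :=
            Finset.single_le_sum (f := fun δ : Fin d × Bool =>
              (if (zdGraph d).Adj x y ∧ ¬ c δ 0 ∧ ¬ c δ x ∧ c δ y then
                isingTwoPoint (torusGraph d L) (W δ) β 0 .free (Torus.proj L 0) (Torus.proj L x) else 0))
              (fun δ _ => hterm δ x hxbox y) (mem_univ δ₁)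
    -- sum the termwise bounds and enlarge the index sets
    have hB : ∑ x ∈ S, ((((zdGraph d).neighborFinset x).filter fun y => y ∉ S).card : ℝ) *
        isingTwoPoint (zdGraph d) S β 0 .free 0 x ≤ ∑ x ∈ box d n, ∑ y ∈ box d n, ∑ δ : Fin d × Bool,
        (if (zdGraph d).Adj x y ∧ ¬ c δ 0 ∧ ¬ c δ x ∧ c δ y then
          isingTwoPoint (torusGraph d L) (W δ) β 0 .free (Torus.proj L 0) (Torus.proj L x) else 0) := by
      calc ∑ x ∈ S, ((((zdGraph d).neighborFinset x).filter fun y => y ∉ S).card : ℝ) *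
            isingTwoPoint (zdGraph d) S β 0 .free 0 x
          = ∑ x ∈ S, ∑ _y ∈ ((zdGraph d).neighborFinset x).filter (fun y => y ∉ S),
              isingTwoPoint (zdGraph d) S β 0 .free 0 x := by
            refine Finset.sum_congr rfl fun x _ => ?_
            rw [Finset.sum_const, nsmul_eq_mul]
        _ ≤ ∑ x ∈ S, ∑ y ∈ ((zdGraph d).neighborFinset x).filter (fun y => y ∉ S),
              ∑ δ : Fin d × Bool,
                (if (zdGraph d).Adj x y ∧ ¬ c δ 0 ∧ ¬ c δ x ∧ c δ y then
                  isingTwoPoint (torusGraph d L) (W δ) β 0 .free (Torus.proj L 0) (Torus.proj L x) else 0) :=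
            sum_le_sum fun x hx => sum_le_sum fun y hy => hA x hx y hy
        _ ≤ ∑ x ∈ S, ∑ y ∈ box d n, ∑ δ : Fin d × Bool,
                (if (zdGraph d).Adj x y ∧ ¬ c δ 0 ∧ ¬ c δ x ∧ c δ y then
                  isingTwoPoint (torusGraph d L) (W δ) β 0 .free (Torus.proj L 0) (Torus.proj L x) else 0) := by
            refine sum_le_sum fun x hx => sum_le_sum_of_subset_of_nonneg ?_ ?_
            · intro y hy
              obtain ⟨hyadj, -⟩ := mem_filter.1 hy
              rw [SimpleGraph.mem_neighborFinset] at hyadj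
              exact mem_box_of_adj_of_mem_box_pred hn (hSpred hx) hyadj
            · intro y _ _
              exact sum_nonneg fun δ _ => hterm δ x (hSbox hx) y
        _ ≤ ∑ x ∈ box d n, ∑ y ∈ box d n, ∑ δ : Fin d × Bool,
                (if (zdGraph d).Adj x y ∧ ¬ c δ 0 ∧ ¬ c δ x ∧ c δ y then
                  isingTwoPoint (torusGraph d L) (W δ) β 0 .free (Torus.proj L 0) (Torus.proj L x) else 0) := by
            refine sum_le_sum_of_subset_of_nonneg hSbox fun x hx _ => ?_
            exact sum_nonneg fun y _ => sum_nonneg fun δ _ => hterm δ x hx y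
    -- reorder the sums
    have hre : ∑ x ∈ box d n, ∑ y ∈ box d n, ∑ δ : Fin d × Bool,
        (if (zdGraph d).Adj x y ∧ ¬ c δ 0 ∧ ¬ c δ x ∧ c δ y then
          isingTwoPoint (torusGraph d L) (W δ) β 0 .free (Torus.proj L 0) (Torus.proj L x) else 0) =
        ∑ δ : Fin d × Bool, ∑ x ∈ box d n, ∑ y ∈ box d n,
          (if (zdGraph d).Adj x y ∧ ¬ c δ 0 ∧ ¬ c δ x ∧ c δ y then
            isingTwoPoint (torusGraph d L) (W δ) β 0 .free (Torus.proj L 0) (Torus.proj L x) else 0) := by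
      calc ∑ x ∈ box d n, ∑ y ∈ box d n, ∑ δ : Fin d × Bool,
            (if (zdGraph d).Adj x y ∧ ¬ c δ 0 ∧ ¬ c δ x ∧ c δ y then
              isingTwoPoint (torusGraph d L) (W δ) β 0 .free (Torus.proj L 0) (Torus.proj L x) else 0)
          = ∑ x ∈ box d n, ∑ δ : Fin d × Bool, ∑ y ∈ box d n,
            (if (zdGraph d).Adj x y ∧ ¬ c δ 0 ∧ ¬ c δ x ∧ c δ y then
              isingTwoPoint (torusGraph d L) (W δ) β 0 .free (Torus.proj L 0) (Torus.proj L x) else 0) :=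
            Finset.sum_congr rfl fun x _ => Finset.sum_comm
        _ = ∑ δ : Fin d × Bool, ∑ x ∈ box d n, ∑ y ∈ box d n,
            (if (zdGraph d).Adj x y ∧ ¬ c δ 0 ∧ ¬ c δ x ∧ c δ y then
              isingTwoPoint (torusGraph d L) (W δ) β 0 .free (Torus.proj L 0) (Torus.proj L x) else 0) :=
            Finset.sum_comm
    rw [hre] at hB
    have h1 := hφS.trans (mul_le_mul_of_nonneg_left hB hw)
    linarith

end Summit.CriticalPhenomena.Ising3DConformalLimit.Cruxes.CoerciveReflectedGradient.BaseBoxRerun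

end
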